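import Literature.Analysis.FluidPDE.PassiveScalarDiagFourier
import Literature.Analysis.FluidPDE.PassiveScalarDiagMild
import Literature.Analysis.FunctionSpaces.DuBoisReymondAE
import HarnessLib

/-!
# The drift-free Fourier (Duhamel) representation of weak solutions of the diagonal-diffusion
  passive scalar equation

Analysis/FluidPDE proof file (everything proved): the `T4` item of the diagonal parabolic layer behind
Hess-Childs–Rowan's flat-torus statements (`AcceleratingDissipationEnhancement`,
`UniversalTotalAnomalousDissipator`). On a horizon where the drift vanishes, EVERY weak solution of
`∂ₜθ = κ ∑ᵢ aᵢ ∂ᵢ∂ᵢθ + s` on `T^d × [0,T)` with datum `θ₀` in the DiPerna–Lions class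
`Torus.IsWeakScalarTransportDiagForcedOn T a κ u s θ₀ θ` (with `u = 0` on `(0,T)`) has, for a.e.
`t ∈ (0,T)` and every `k ∈ ℤ^d`, the Fourier coefficients of the heat flow with source:

  `𝓕θ(t)(k) = e^{-νₖt} 𝓕θ₀(k) + ∫_{(0,t]} e^{-νₖ(t-τ)} 𝓕(s(τ))(k) dτ`,  `νₖ = 4π²κ ∑ᵢ aᵢ kᵢ²`

(`IsWeakScalarTransportDiagForcedOn.ae_mFourierCoeff_eq_duhamel`; Duhamel's formula, Pazy 1983,
Ch. 4 §4.2, (2.3)), and for a steady source `s(t) = S` the closed form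
`e^{-νₖt} 𝓕θ₀(k) + (1 - e^{-νₖt})/νₖ · 𝓕S(k)` for `νₖ ≠ 0`
(`ae_mFourierCoeff_eq_of_steady`), `𝓕θ₀(0) + t 𝓕S(0)` at `k = 0`.

Proof: the tree's modewise integral identity `IsWeakScalarTransportDiagForcedOn.ae_mFourierCoeff_eq`
(`PassiveScalarDiagFourier`) reads, without drift, `y(t) = y₀ + ∫_{(0,t]}(-ν y + f)` for a.e. `t`
(`y = 𝓕θ(·)(k)`, `f = 𝓕s(·)(k)`); its right-hand side `Y` is a continuous solution of the same
Volterra equation at every `t`, and the **product formula for primitives**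
(`FunctionSpaces.mul_eq_add_setIntegral_of_eq_add_setIntegral`, applied to `e^{νt}` and the real and
imaginary parts of `Y`) gives `e^{νt}Y(t) = y₀ + ∫_{(0,t]} e^{ντ} f(τ) dτ` — variation of constants
without differentiating the (merely absolutely continuous) `Y`.

## References

* A. Pazy, *Semigroups of Linear Operators and Applications to PDE*, Springer 1983, Ch. 4 §4.2, (2.3)
  and Def. 2.3 (mild solution, Duhamel's formula). [`Pazy1983`]
* R. J. DiPerna, P.-L. Lions, Invent. Math. 98 (1989), §II.1, (13)–(14) (modewise weak formulation).
  [`DiPernaLions1989`]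
-/

noncomputable section

open MeasureTheory TopologicalSpace Set Function Filter UnitAddTorus Complex
open _root_.Topology
open scoped ENNReal NNReal InnerProductSpace ComplexConjugate

namespace Literature.Analysis.FluidPDE

namespace Torus

open Literature.Analysis.FunctionSpaces.Torus Literature.Analysis.FunctionSpaces

variable {d : Type*} [Fintype d] [DecidableEq d]

/-! ## Variation of constants for the scalar Volterra equation `Y(t) = y₀ + ∫_{(0,t]} (-ν Y + f)` -/

section Volterra

omit [Fintype d] [DecidableEq d]

/-- The exponential weight as a primitive: `e^{νt} = 1 + ∫_{(0,t]} ν e^{ντ} dτ` (`t ≥ 0`). [cite: Pazy1983, Ch. 4 §4.2, (2.2)–(2.3), p. 105] -/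
theorem exp_mul_eq_one_add_setIntegral (ν : ℝ) {t : ℝ} (ht : 0 ≤ t) :
    Real.exp (ν * t) = 1 + ∫ τ in Ioc 0 t, ν * Real.exp (ν * τ) := by
  have hderiv : ∀ τ ∈ uIcc 0 t, HasDerivAt (fun τ => Real.exp (ν * τ)) (ν * Real.exp (ν * τ)) τ := by
    intro τ _
    have h := ((hasDerivAt_id τ).const_mul ν).exp
    simp only [id, mul_one] at h
    convert h using 1; ring
  rw [← intervalIntegral.integral_of_le ht,
    intervalIntegral.integral_eq_sub_of_hasDerivAt hderiv ((by fun_prop : Continuous fun τ =>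
      ν * Real.exp (ν * τ)).intervalIntegrable _ _)]
  simp

/-- **Variation of constants, real case.** If `G(t) = β + ∫_{(0,t]} (-ν G + g)` on `(0,T]` with
`g ∈ L¹(0,T)` and `G` integrable on `(0,T)`, then `e^{νt} G(t) = β + ∫_{(0,t]} e^{ντ} g(τ) dτ` on
`(0,T]` (the product formula for the primitives `e^{ν·}` and `G`: the `ν e^{ντ}G` terms cancel).
[cite: Pazy1983, Ch. 4 §4.2, (2.2)–(2.3), p. 105] -/
theorem exp_mul_eq_of_volterra {T ν β : ℝ} {G g : ℝ → ℝ} (hg : IntegrableOn g (Ioo 0 T))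
    (hG : IntegrableOn G (Ioo 0 T)) (hGeq : ∀ t ∈ Ioc 0 T, G t = β + ∫ τ in Ioc 0 t, (-ν * G τ + g τ))
    {t : ℝ} (ht : t ∈ Ioc 0 T) :
    Real.exp (ν * t) * G t = β + ∫ τ in Ioc 0 t, Real.exp (ν * τ) * g τ := by
  have hφ : IntegrableOn (fun τ => ν * Real.exp (ν * τ)) (Ioo 0 T) :=
    ((by fun_prop : Continuous fun τ => ν * Real.exp (ν * τ)).integrableOn_Icc).mono_set Ioo_subset_Icc_self
  have hγ : IntegrableOn (fun τ => -ν * G τ + g τ) (Ioo 0 T) := (hG.const_mul _).add hg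
  have hF : ∀ t ∈ Ioc 0 T, Real.exp (ν * t) = 1 + ∫ τ in Ioc 0 t, ν * Real.exp (ν * τ) := fun t ht =>
    exp_mul_eq_one_add_setIntegral ν ht.1.le
  obtain ⟨hint, hprod⟩ := mul_eq_add_setIntegral_of_eq_add_setIntegral hφ hγ hF hGeq ht
  rw [hprod, one_mul]
  congr 1
  refine integral_congr_ae (ae_of_all _ fun τ => ?_)
  ring

end Volterra

/-! ## The drift-free Duhamel representation -/

namespace IsWeakScalarTransportDiagForcedOn

variable {T κ : ℝ} {a : d → ℝ} {u : ℝ → UnitAddTorus d → EuclideanSpace ℝ d}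
  {s : ℝ → UnitAddTorus d → ℝ} {θ₀ : UnitAddTorus d → ℝ} {θ : ℝ → UnitAddTorus d → ℝ}

/-- **Drift-free modewise Volterra equation**: if the drift vanishes on `(0,T)`, then for a.e.
`t ∈ (0,T)`, `𝓕θ(t)(k) = 𝓕θ₀(k) + ∫_{(0,t]} (-νₖ 𝓕θ(τ)(k) + 𝓕s(τ)(k)) dτ` with `νₖ = diagRate κ a k`
(the tree's `ae_mFourierCoeff_eq` with the transport term removed). [cite: DiPernaLions1989, §II.1 (13)–(14)] -/
theorem ae_mFourierCoeff_eq_of_velocity_zero (h : IsWeakScalarTransportDiagForcedOn T a κ u s θ₀ θ)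
    (hθ₀ : Integrable θ₀ volume) (hu0 : ∀ t ∈ Ioo 0 T, u t = 0) (k : d → ℤ) :
    ∀ᵐ t ∂((volume : Measure ℝ).restrict (Ioo 0 T)),
      mFourierCoeff (fun x => (θ t x : ℂ)) k = mFourierCoeff (fun x => (θ₀ x : ℂ)) k +
        ∫ τ in Ioc 0 t, (-((diagRate κ a k : ℝ) : ℂ) * mFourierCoeff (fun x => (θ τ x : ℂ)) k +
          mFourierCoeff (fun x => (s τ x : ℂ)) k) := by
  filter_upwards [h.ae_mFourierCoeff_eq hθ₀ k, ae_restrict_mem measurableSet_Ioo] with t ht htI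
  rw [ht]
  congr 1
  refine setIntegral_congr_fun measurableSet_Ioc fun τ hτ => ?_
  have hτ' : τ ∈ Ioo 0 T := ⟨hτ.1, lt_of_le_of_lt hτ.2 htI.2⟩
  have h0 : ∀ j, mFourierCoeff (fun x => ((θ τ x * u τ x j : ℝ) : ℂ)) k = 0 := by
    intro j
    have : (fun x => ((θ τ x * u τ x j : ℝ) : ℂ)) = fun _ => 0 := by
      funext x; rw [hu0 τ hτ']; simp
    rw [this, mFourierCoeff_eq_integral_volume]; simp
  simp only [h0, mul_zero, Finset.sum_const_zero, sub_zero, diagRate_apply, diagFreqSq_apply]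

/-- **The drift-free Duhamel representation** (Duhamel's formula for the heat flow with source, mode
by mode). If the drift vanishes on `(0,T)` and `θ₀ ∈ L¹`, then for every `k ∈ ℤ^d` and a.e.
`t ∈ (0,T)`:
`𝓕θ(t)(k) = e^{-νₖt} 𝓕θ₀(k) + ∫_{(0,t]} e^{-νₖ(t-τ)} 𝓕(s(τ))(k) dτ`, `νₖ = 4π²κ∑ᵢaᵢkᵢ²`
(variation of constants on the modewise Volterra equation, through the product formula for
primitives on real and imaginary parts). [cite: Pazy1983, Ch. 4 §4.2, (2.3) and Def. 2.3 (mild solution), p. 106] -/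
theorem ae_mFourierCoeff_eq_duhamel (h : IsWeakScalarTransportDiagForcedOn T a κ u s θ₀ θ)
    (hθ₀ : Integrable θ₀ volume) (hu0 : ∀ t ∈ Ioo 0 T, u t = 0) (k : d → ℤ) :
    ∀ᵐ t ∂((volume : Measure ℝ).restrict (Ioo 0 T)),
      mFourierCoeff (fun x => (θ t x : ℂ)) k =
        ((Real.exp (-(diagRate κ a k * t)) : ℝ) : ℂ) * mFourierCoeff (fun x => (θ₀ x : ℂ)) k +
        ∫ τ in Ioc 0 t, ((Real.exp (-(diagRate κ a k * (t - τ))) : ℝ) : ℂ) * mFourierCoeff (fun x => (s τ x : ℂ)) k := by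
  set ν : ℝ := diagRate κ a k with hν
  set y : ℝ → ℂ := fun t => mFourierCoeff (fun x => (θ t x : ℂ)) k with hy
  set y₀ : ℂ := mFourierCoeff (fun x => (θ₀ x : ℂ)) k with hy₀
  set f : ℝ → ℂ := fun τ => mFourierCoeff (fun x => (s τ x : ℂ)) k with hf
  have hyi : IntegrableOn y (Ioo 0 T) := h.integrableOn_mFourierCoeff k
  have hfi : IntegrableOn f (Ioo 0 T) := h.integrableOn_mFourierCoeff_source k
  have hgi : IntegrableOn (fun τ => -(ν : ℂ) * y τ + f τ) (Ioo 0 T) := (hyi.const_mul _).add hfi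
  -- the continuous representative `Y` of the Volterra equation
  set Y : ℝ → ℂ := fun t => y₀ + ∫ τ in Ioc 0 t, (-(ν : ℂ) * y τ + f τ) with hY
  have hae : ∀ᵐ t ∂((volume : Measure ℝ).restrict (Ioo 0 T)), y t = Y t :=
    h.ae_mFourierCoeff_eq_of_velocity_zero hθ₀ hu0 k
  -- `Y` solves the Volterra equation at EVERY `t ∈ (0,T]`
  have hYeq : ∀ t ∈ Ioc 0 T, Y t = y₀ + ∫ τ in Ioc 0 t, (-(ν : ℂ) * Y τ + f τ) := by
    intro t ht
    simp only [hY]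
    congr 1
    refine integral_congr_ae ?_
    have h1 : ∀ᵐ τ ∂((volume : Measure ℝ).restrict (Ioc 0 T)), y τ = Y τ := by
      rwa [← Measure.restrict_congr_set (Ioo_ae_eq_Ioc (μ := (volume : Measure ℝ)))]
    filter_upwards [ae_restrict_of_ae_restrict_of_subset (Ioc_subset_Ioc_right ht.2) h1] with τ hτ
    rw [hτ]
  have hYi : IntegrableOn Y (Ioo 0 T) := hyi.congr hae
  have hgY : IntegrableOn (fun τ => -(ν : ℂ) * Y τ + f τ) (Ioo 0 T) := (hYi.const_mul _).add hfi
  have hgYt : ∀ t ∈ Ioc 0 T, IntegrableOn (fun τ => -(ν : ℂ) * Y τ + f τ) (Ioc 0 t) := fun t ht =>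
    (integrableOn_Ioc_iff_integrableOn_Ioo (f := fun τ => -(ν : ℂ) * Y τ + f τ)).2
      (hgY.mono_set (Ioo_subset_Ioo_right ht.2))
  -- real and imaginary parts: `G = β + ∫ (-ν G + g)`
  have hre : ∀ t ∈ Ioc 0 T, (Y t).re = y₀.re + ∫ τ in Ioc 0 t, (-ν * (Y τ).re + (f τ).re) := by
    intro t ht
    have h2 := integral_re (hgYt t ht)
    simp only [RCLike.re_to_complex] at h2
    rw [hYeq t ht, Complex.add_re, ← h2]
    congr 1
    refine integral_congr_ae (ae_of_all _ fun τ => ?_)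
    simp only [Complex.add_re, Complex.neg_re, Complex.mul_re, Complex.ofReal_re, Complex.ofReal_im,
      zero_mul, sub_zero, neg_mul]
  have him : ∀ t ∈ Ioc 0 T, (Y t).im = y₀.im + ∫ τ in Ioc 0 t, (-ν * (Y τ).im + (f τ).im) := by
    intro t ht
    have h2 := integral_im (hgYt t ht)
    simp only [RCLike.im_to_complex] at h2
    rw [hYeq t ht, Complex.add_im, ← h2]
    congr 1
    refine integral_congr_ae (ae_of_all _ fun τ => ?_)
    simp only [Complex.add_im, Complex.neg_im, Complex.mul_im, Complex.ofReal_re, Complex.ofReal_im,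
      zero_mul, add_zero, neg_mul]
  -- variation of constants on both parts
  have hRe : ∀ t ∈ Ioc 0 T, Real.exp (ν * t) * (Y t).re = y₀.re + ∫ τ in Ioc 0 t, Real.exp (ν * τ) * (f τ).re :=
    fun t ht => by
      simpa only [Complex.reCLM_apply] using exp_mul_eq_of_volterra (Complex.reCLM.integrable_comp hfi)
        (Complex.reCLM.integrable_comp hYi) hre ht
  have hIm : ∀ t ∈ Ioc 0 T, Real.exp (ν * t) * (Y t).im = y₀.im + ∫ τ in Ioc 0 t, Real.exp (ν * τ) * (f τ).im :=
    fun t ht => by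
      simpa only [Complex.imCLM_apply] using exp_mul_eq_of_volterra (Complex.imCLM.integrable_comp hfi)
        (Complex.imCLM.integrable_comp hYi) him ht
  -- assemble: `e^{νt} Y t = y₀ + ∫ e^{ντ} f`
  have hexpY : ∀ t ∈ Ioc 0 T, ((Real.exp (ν * t) : ℝ) : ℂ) * Y t =
      y₀ + ∫ τ in Ioc 0 t, ((Real.exp (ν * τ) : ℝ) : ℂ) * f τ := by
    intro t ht
    have hi : IntegrableOn (fun τ => ((Real.exp (ν * τ) : ℝ) : ℂ) * f τ) (Ioc 0 t) := by
      refine (integrableOn_Ioc_iff_integrableOn_Ioo (f := fun τ => ((Real.exp (ν * τ) : ℝ) : ℂ) * f τ)).2 ?_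
      refine (hfi.mono_set (Ioo_subset_Ioo_right ht.2)).bdd_mul (c := Real.exp (|ν| * T))
        (Complex.continuous_ofReal.comp (by fun_prop)).aestronglyMeasurable ?_
      filter_upwards [ae_restrict_mem measurableSet_Ioo] with τ hτ
      rw [Complex.norm_real, Real.norm_of_nonneg (Real.exp_pos _).le, Real.exp_le_exp]
      calc ν * τ ≤ |ν| * τ := mul_le_mul_of_nonneg_right (le_abs_self ν) hτ.1.le
        _ ≤ |ν| * T := mul_le_mul_of_nonneg_left (hτ.2.le.trans ht.2) (abs_nonneg ν)
    have h2 := integral_re hi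
    have h3 := integral_im hi
    simp only [RCLike.re_to_complex, RCLike.im_to_complex, Complex.re_ofReal_mul, Complex.im_ofReal_mul] at h2 h3
    refine Complex.ext ?_ ?_
    · have lhs : ((((Real.exp (ν * t) : ℝ) : ℂ)) * Y t).re = Real.exp (ν * t) * (Y t).re :=
        Complex.re_ofReal_mul _ _
      rw [lhs, hRe t ht, Complex.add_re, ← h2]
    · have lhs : ((((Real.exp (ν * t) : ℝ) : ℂ)) * Y t).im = Real.exp (ν * t) * (Y t).im :=
        Complex.im_ofReal_mul _ _
      rw [lhs, hIm t ht, Complex.add_im, ← h3]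
  -- divide by `e^{νt}` and pull the factor into the integral
  filter_upwards [hae, ae_restrict_mem measurableSet_Ioo] with t hyt htI
  have ht : t ∈ Ioc 0 T := ⟨htI.1, htI.2.le⟩
  have hE : ((Real.exp (-(ν * t)) : ℝ) : ℂ) * (((Real.exp (ν * t) : ℝ) : ℂ)) = 1 := by
    rw [← Complex.ofReal_mul, ← Real.exp_add]; simp
  rw [show mFourierCoeff (fun x => (θ t x : ℂ)) k = y t from rfl, hyt]
  calc Y t = ((Real.exp (-(ν * t)) : ℝ) : ℂ) * ((((Real.exp (ν * t) : ℝ) : ℂ)) * Y t) := by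
        rw [← mul_assoc, hE, one_mul]
    _ = ((Real.exp (-(ν * t)) : ℝ) : ℂ) * y₀ +
        ((Real.exp (-(ν * t)) : ℝ) : ℂ) * ∫ τ in Ioc 0 t, ((Real.exp (ν * τ) : ℝ) : ℂ) * f τ := by
        rw [hexpY t ht, mul_add]
    _ = ((Real.exp (-(ν * t)) : ℝ) : ℂ) * y₀ +
        ∫ τ in Ioc 0 t, ((Real.exp (-(ν * (t - τ))) : ℝ) : ℂ) * f τ := by
        rw [← integral_const_mul]
        congr 1
        refine integral_congr_ae (ae_of_all _ fun τ => ?_)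
        dsimp only
        rw [← mul_assoc, ← Complex.ofReal_mul, ← Real.exp_add]
        congr 3; ring

/-- **Steady source, nonzero rate**: if moreover `s(t) = S` for `t ∈ (0,T)` and `νₖ ≠ 0` (i.e.
`k ≠ 0` when all `aᵢ > 0`, `κ > 0`), then for a.e. `t ∈ (0,T)`,
`𝓕θ(t)(k) = e^{-νₖt} 𝓕θ₀(k) + (1 - e^{-νₖt}) νₖ⁻¹ 𝓕S(k)` — exponential relaxation of each mode to
the steady profile `𝓕S(k)/νₖ`. [cite: Pazy1983, Ch. 4 §4.2, (2.3) and Def. 2.3 (mild solution), p. 106] -/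
theorem ae_mFourierCoeff_eq_of_steady (h : IsWeakScalarTransportDiagForcedOn T a κ u s θ₀ θ)
    (hθ₀ : Integrable θ₀ volume) (hu0 : ∀ t ∈ Ioo 0 T, u t = 0) {S : UnitAddTorus d → ℝ}
    (hS : ∀ t ∈ Ioo 0 T, s t = S) (k : d → ℤ) (hν : diagRate κ a k ≠ 0) :
    ∀ᵐ t ∂((volume : Measure ℝ).restrict (Ioo 0 T)),
      mFourierCoeff (fun x => (θ t x : ℂ)) k =
        ((Real.exp (-(diagRate κ a k * t)) : ℝ) : ℂ) * mFourierCoeff (fun x => (θ₀ x : ℂ)) k +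
        (((1 - Real.exp (-(diagRate κ a k * t))) / diagRate κ a k : ℝ) : ℂ) * mFourierCoeff (fun x => (S x : ℂ)) k := by
  set ν : ℝ := diagRate κ a k with hνdef
  filter_upwards [h.ae_mFourierCoeff_eq_duhamel hθ₀ hu0 k, ae_restrict_mem measurableSet_Ioo] with t ht htI
  rw [ht]
  congr 1
  have e1 : ∫ τ in Ioc 0 t, ((Real.exp (-(ν * (t - τ))) : ℝ) : ℂ) * mFourierCoeff (fun x => (s τ x : ℂ)) k =
      ∫ τ in Ioc 0 t, ((Real.exp (-(ν * (t - τ))) : ℝ) : ℂ) * mFourierCoeff (fun x => (S x : ℂ)) k := by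
    refine setIntegral_congr_fun measurableSet_Ioc fun τ hτ => ?_
    rw [hS τ ⟨hτ.1, lt_of_le_of_lt hτ.2 htI.2⟩]
  rw [e1, integral_mul_const, integral_complex_ofReal]
  congr 1
  -- `∫_{(0,t]} e^{-ν(t-τ)} dτ = (1 - e^{-νt})/ν`
  have hderiv : ∀ τ ∈ uIcc 0 t, HasDerivAt (fun τ => Real.exp (-(ν * (t - τ))) / ν)
      (Real.exp (-(ν * (t - τ)))) τ := by
    intro τ _
    have h1 : HasDerivAt (fun τ => -(ν * (t - τ))) ν τ := by
      have e : (fun τ => -(ν * (t - τ))) = fun τ => ν * τ + -(ν * t) := by funext τ; ring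
      rw [e]; simpa using ((hasDerivAt_id τ).const_mul ν).add_const (-(ν * t))
    have h2 := (h1.exp).div_const ν
    refine h2.congr_deriv ?_
    field_simp
  rw [← intervalIntegral.integral_of_le htI.1.le,
    intervalIntegral.integral_eq_sub_of_hasDerivAt hderiv ((by fun_prop : Continuous fun τ =>
      Real.exp (-(ν * (t - τ)))).intervalIntegrable _ _)]
  simp only [sub_self, mul_zero, neg_zero, Real.exp_zero, sub_zero]
  push_cast
  ring

/-- **Steady source, the mean mode**: at `k = 0` (`ν₀ = 0`), `𝓕θ(t)(0) = 𝓕θ₀(0) + t 𝓕S(0)` for a.e.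
`t ∈ (0,T)` — the mean grows linearly with the mean of the source. [cite: Pazy1983, Ch. 4 §4.2, (2.3) and Def. 2.3 (mild solution), p. 106] -/
theorem ae_mFourierCoeff_zero_eq_of_steady (h : IsWeakScalarTransportDiagForcedOn T a κ u s θ₀ θ)
    (hθ₀ : Integrable θ₀ volume) (hu0 : ∀ t ∈ Ioo 0 T, u t = 0) {S : UnitAddTorus d → ℝ}
    (hS : ∀ t ∈ Ioo 0 T, s t = S) :
    ∀ᵐ t ∂((volume : Measure ℝ).restrict (Ioo 0 T)),
      mFourierCoeff (fun x => (θ t x : ℂ)) 0 =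
        mFourierCoeff (fun x => (θ₀ x : ℂ)) 0 + (t : ℂ) * mFourierCoeff (fun x => (S x : ℂ)) 0 := by
  have hν : diagRate κ a (0 : d → ℤ) = 0 := by simp [diagRate_apply, diagFreqSq_apply]
  filter_upwards [h.ae_mFourierCoeff_eq_duhamel hθ₀ hu0 0, ae_restrict_mem measurableSet_Ioo] with t ht htI
  rw [ht, hν]
  simp only [zero_mul, neg_zero, Real.exp_zero, Complex.ofReal_one, one_mul]
  congr 1
  have e1 : ∫ τ in Ioc 0 t, mFourierCoeff (fun x => (s τ x : ℂ)) 0 =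
      ∫ τ in Ioc 0 t, mFourierCoeff (fun x => (S x : ℂ)) 0 := by
    refine setIntegral_congr_fun measurableSet_Ioc fun τ hτ => ?_
    rw [hS τ ⟨hτ.1, lt_of_le_of_lt hτ.2 htI.2⟩]
  rw [e1, setIntegral_const, Real.volume_real_Ioc_of_le htI.1.le, sub_zero, Complex.real_smul]

end IsWeakScalarTransportDiagForcedOn

end Torus

end Literature.Analysis.FluidPDE

end
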